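import Summits.HodgeConjecture.CorCM.GaloisThirtyTwoDividesSmallPrimeHodge
import Summits.HodgeConjecture.CorCM.GaloisQuaternionEightCyclic61Lift
import Summits.HodgeConjecture.CorCM.GaloisQuaternionTimesCyclicDegenerate
import HarnessLib

/-!
# `p = 61`: shapes Q×/QK are BAD, GOOD Galois CM fields of degree `2ⁿ·61` (`n ≥ 5`) have shape C(r) or Dic and satisfy the Hodge
# conjecture for all powers of all their CM abelian varieties; `Gal ≅ Q_{8k} × C₆₁` is BAD

COR-CM (cell `pub-hodgecm2`), binder seat b04 (gen 39), count-neutral own lane «Galois-CM-type classification».  KERNEL ONLY: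
theorems; no definition, no named fact, no `sorry`.  `HC_CM` is neither used nor claimed.

The `p = 61` column of gen 39's results (`CorCM/GaloisOddPrimeShapesQuaternionBad(B)`, `CorCM/GaloisThirtyTwoDividesSmallPrimeHodge`,
`CorCM/GaloisQuaternionTimesCyclicDegenerate`), fed by the split kernel certificate `CorCM/GaloisQuaternionEightCyclic61Lift`:
`61 − 1 = 60` (`v₂ = 2`), `61 + 1 = 62` (`v₂ = 1`), so every shape C(r) has `ord r ∣ 4` (`j = 2`) and gen 38's conditions
`2^{n−1} ∤ 60`, `2^{n−2} ∤ 62` hold for `n ≥ 5`.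

* `exists_simple_degenerate_of_shape_quaternion_sixtyone`, `structure_of_forall_isNondegenerate_of_thirtytwo_dvd_sixtyone`,
  **`hodgeConjectureFor_pow_of_forall_isNondegenerate_sixtyone`**, `hodge_dichotomy_sixtyone`,
  `exists_simple_degenerate_of_mulEquiv_quaternion_prod_cyclic61`.

## References

* [Shimura1998] G. Shimura, *Abelian Varieties with Complex Multiplication and Modular Functions*, §6.2 Thm. 3, §8.2 Prop. 26, §32.10.
* [Gordon1999HodgeAVSurvey] B. B. Gordon, *A survey of the Hodge conjecture for abelian varieties*, Thm. 6.4, §9.3.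
* [Pohlmann1968] H. Pohlmann, *Algebraic cycles on abelian varieties of complex multiplication type*, Ann. of Math. 88 (1968), Thm. 1.
* [Dodson1984] B. Dodson, *The structure of Galois groups of CM-fields*, Trans. AMS 283 (1984), §3.1.1, §4.1, §5.
-/

noncomputable section

open CategoryTheory CategoryTheory.Limits NumberField
open scoped BigOperators

namespace Summit.HodgeConjecture.CorCM.GaloisModels

open Literature.NumberTheory.ComplexMultiplication Literature.AlgebraicGeometry.HodgeTheory
open Literature.AlgebraicGeometry.Motives (AbelianVariety CMType)
open Literature.AlgebraicGeometry.ComplexMultiplication (IsCMTypeRealisation)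
open Literature.AlgebraicGeometry.Pohlmann1968 Summit.HodgeConjecture.CorCM.GaloisRank
open Literature.Barriers.HodgeConjecture (divisorClassesSpan)
open QuaternionGroup

variable {K : Type} [Field K] [NumberField K] [IsCMField K]

/-- **SHAPES Q× AND QK ARE BAD FOR `p = 61`** (`n ≥ 4`; subgroup `⟨a^{2ⁿ⁻³}, x⟩ × ⟨u⟩ ≅ Q₈ × C₆₁` through `c`).
[cite: Shimura1998, §6.2 Thm. 3 and §8.2 Prop. 26] [cite: Gordon1999HodgeAVSurvey, Thm. 6.4 and §9.3] -/
theorem exists_simple_degenerate_of_shape_quaternion_sixtyone [IsGalois ℚ K] {n : ℕ} (hn : 4 ≤ n) {u a x : K ≃ₐ[ℚ] K}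
    (hu : orderOf u = 61) (hnorm : (Subgroup.zpowers u).Normal) (ha : orderOf a = 2 ^ (n - 1)) (hxa : x * a = a⁻¹ * x)
    (hxx : x * x = a ^ 2 ^ (n - 2)) (hc : a ^ 2 ^ (n - 2) = (IsCMField.complexConj K).restrictScalars ℚ)
    (hxu : x * u * x⁻¹ = u) (hau : a * u * a⁻¹ = u ∨ a * u * a⁻¹ = u⁻¹) :
    ∃ (Φ : CMType K) (φ₀ : K →+* ℂ) (A : AbelianVariety ℂ) (ι : 𝓞 K →+* End A)
      (θ : K →+* Module.End ℂ (complexBetti A.X 1)),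
      IsPrimitive (ℂ ≃+* ℂ) Φ.1 φ₀ ∧ ¬ IsNondegenerate Φ ∧ IsCMTypeRealisation Φ A ι θ ∧ A.IsSimple ∧
      A.dim = Module.finrank ℚ K / 2 ∧
      ∃ n p : ℕ, ∃ x : complexBetti (⨁ fun _ : Fin n => A).X (2 * p), IsRationalClass x ∧
        IsOfHodgeType (⨁ fun _ : Fin n => A).dim (⨁ fun _ : Fin n => A).X (2 * p) p p x ∧
        x ∉ divisorClassesSpan (⨁ fun _ : Fin n => A).X (⨁ fun _ : Fin n => A).dim p := by
  have h23 : 2 ^ (n - 3) * 2 = 2 ^ (n - 2) := by rw [← pow_succ]; congr 1; omega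
  have hA : orderOf (a ^ 2 ^ (n - 3)) = 4 := by
    rw [orderOf_pow_of_dvd (pow_ne_zero _ two_ne_zero) (by rw [ha]; exact pow_dvd_pow 2 (by omega)), ha,
      Nat.pow_div (by omega) two_pos]
    rw [show n - 1 - (n - 3) = 2 by omega]
    norm_num
  have hX : x * x = (a ^ 2 ^ (n - 3)) ^ 2 := by rw [hxx, ← pow_mul, h23]
  have hXA : x * a ^ 2 ^ (n - 3) * x⁻¹ = (a ^ 2 ^ (n - 3))⁻¹ := conj_pow_eq_inv_of_mul_eq hxa _
  have hc' : (a ^ 2 ^ (n - 3)) ^ 2 = (IsCMField.complexConj K).restrictScalars ℚ := by rw [← pow_mul, h23, hc]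
  have hAu : a ^ 2 ^ (n - 3) * u = u * a ^ 2 ^ (n - 3) := by
    rcases hau with hau | hau
    · exact ((show Commute a u from mul_comm_of_conj_eq hau).pow_left _).eq
    · have h24 : 2 ^ (n - 3) = 2 * 2 ^ (n - 4) := by rw [← pow_succ']; congr 1; omega
      rw [h24]
      exact pow_two_mul_comm_of_conj_eq_inv hau _
  have hXu : x * u = u * x := mul_comm_of_conj_eq hxu
  exact exists_simple_degenerate_of_quaternionEight_cyclic61_subgroup hA hX hXA hc' hu hAu hXu hnorm

/-- **GOOD Galois CM fields of degree `2ⁿ·61`, `n ≥ 5`: shape C(r) or Dic.** [cite: Shimura1998, §8.2 Prop. 26 and §32.10]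
[cite: Dodson1984, §3.1.1, §4.1 and §5] -/
theorem structure_of_forall_isNondegenerate_of_thirtytwo_dvd_sixtyone [IsGalois ℚ K] {n : ℕ}
    (hdeg : Module.finrank ℚ K = 2 ^ n * 61) (hn : 5 ≤ n)
    (hgood : ∀ (Φ : CMType K) (φ : K →+* ℂ), IsPrimitive (ℂ ≃+* ℂ) Φ.1 φ → IsNondegenerate Φ) [Fact (Nat.Prime 2)] :
    (∀ σ : K ≃ₐ[ℚ] K, σ * σ = 1 → σ ≠ 1 → σ = (IsCMField.complexConj K).restrictScalars ℚ) ∧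
      ∀ S : Sylow 2 (K ≃ₐ[ℚ] K), Nat.card (S : Subgroup (K ≃ₐ[ℚ] K)) = 2 ^ n ∧
        ((∃ u x : K ≃ₐ[ℚ] K, orderOf u = 61 ∧ (Subgroup.zpowers u).Normal ∧ orderOf x = 2 ^ n ∧
            Subgroup.zpowers x = (S : Subgroup (K ≃ₐ[ℚ] K)) ∧ (∀ g : K ≃ₐ[ℚ] K, ∃ j i : ℕ, g = u ^ j * x ^ i) ∧
            ∃ r : ℕ, x * u * x⁻¹ = u ^ r) ∨
         (∃ u a x : K ≃ₐ[ℚ] K, orderOf u = 61 ∧ (Subgroup.zpowers u).Normal ∧ orderOf a = 2 ^ (n - 1) ∧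
            a ∈ (S : Subgroup (K ≃ₐ[ℚ] K)) ∧ x ∈ (S : Subgroup (K ≃ₐ[ℚ] K)) ∧ x ∉ Subgroup.zpowers a ∧ x * a = a⁻¹ * x ∧
            x * x = a ^ 2 ^ (n - 2) ∧ (∀ g : K ≃ₐ[ℚ] K, ∃ j i : ℕ, g = u ^ j * a ^ i ∨ g = u ^ j * (x * a ^ i)) ∧
            a * u * a⁻¹ = u ∧ x * u * x⁻¹ = u⁻¹)) := by
  rcases structure_of_forall_isNondegenerate_of_thirtytwo_dvd hdeg (by decide) hn hgood with ⟨hM1, -⟩ | ⟨-, hinv, hS⟩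
  · exact absurd hM1 (by decide)
  refine ⟨hinv, fun S => ?_⟩
  obtain ⟨hcardS, hshape⟩ := hS S
  refine ⟨hcardS, ?_⟩
  rcases hshape with hcyc | ⟨u, a, x, hu, hnorm, ha, haS, hxS, hxa', hxa, hxx, hgen, hshapes⟩
  · exact Or.inl hcyc
  right
  have hc : a ^ 2 ^ (n - 2) = (IsCMField.complexConj K).restrictScalars ℚ := by
    refine hinv _ ?_ ?_
    · rw [← pow_add, ← two_mul, ← pow_succ', show n - 2 + 1 = n - 1 by omega, ← ha, pow_orderOf_eq_one]
    · exact pow_ne_one_of_lt_orderOf (pow_ne_zero _ two_ne_zero) (by rw [ha]; exact Nat.pow_lt_pow_right (by norm_num) (by omega))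
  have hbad : (a * u * a⁻¹ = u ∨ a * u * a⁻¹ = u⁻¹) → x * u * x⁻¹ = u → False := fun hau hxu => by
    obtain ⟨Φ, φ₀, -, -, -, hprim, hdeg', -⟩ :=
      exists_simple_degenerate_of_shape_quaternion_sixtyone (by omega) hu hnorm ha hxa hxx hc hxu hau
    exact hdeg' (hgood Φ φ₀ hprim)
  rcases hshapes with ⟨hau, hxu⟩ | hdic | ⟨hau, hxu⟩
  · exact (hbad (Or.inl hau) hxu).elim
  · exact ⟨u, a, x, hu, hnorm, ha, haS, hxS, hxa', hxa, hxx, hgen, hdic⟩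
  · exact (hbad (Or.inr hau) hxu).elim

variable {Φ : CMType K} {A : AbelianVariety ℂ} {ι : 𝓞 K →+* End A} {θ : K →+* Module.End ℂ (complexBetti A.X 1)}

/-- **A GOOD Galois CM field of degree `2ⁿ·61`, `n ≥ 5`, satisfies the Hodge conjecture for all powers of every abelian variety with CM
by `K`** (`j = 2`: `2^{n−1} ∤ 60`, `2^{n−2} ∤ 62`). [cite: Pohlmann1968, Thm. 1] [cite: Shimura1998, §8.2 Prop. 26 and §32.10]
[cite: Gordon1999HodgeAVSurvey, Thm. 6.4 and §9.3] -/
theorem hodgeConjectureFor_pow_of_forall_isNondegenerate_sixtyone [IsGalois ℚ K] {n : ℕ}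
    (hdeg : Module.finrank ℚ K = 2 ^ n * 61) (hn : 5 ≤ n)
    (hgood : ∀ (Ψ : CMType K) (φ : K →+* ℂ), IsPrimitive (ℂ ≃+* ℂ) Ψ.1 φ → IsNondegenerate Ψ)
    (hA : IsCMTypeRealisation Φ A ι θ) (N : ℕ) :
    HodgeConjectureFor (⨁ fun _ : Fin N => A).dim (⨁ fun _ : Fin N => A).X := by
  haveI : Fact (Nat.Prime 2) := ⟨Nat.prime_two⟩
  haveI : Fact (Nat.Prime 61) := ⟨by norm_num⟩
  obtain ⟨S⟩ : Nonempty (Sylow 2 (K ≃ₐ[ℚ] K)) := inferInstance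
  obtain ⟨-, hS⟩ := structure_of_forall_isNondegenerate_of_thirtytwo_dvd_sixtyone hdeg hn hgood
  obtain ⟨-, hcyc | hdic⟩ := hS S
  · obtain ⟨u, x, hu, hnorm, hx, -, -, r, hxu⟩ := hcyc
    haveI := hnorm
    have hx1 : x ^ 2 ^ n = 1 := by rw [← hx, pow_orderOf_eq_one]
    obtain ⟨a, rfl⟩ : ∃ a, n = a + 2 + 1 := ⟨n - 3, by omega⟩
    exact hodgeConjectureFor_pow_of_shape_C (p := 61) (by norm_num) (by norm_num) (by omega) hdeg hu hx hxu
      (pow_two_pow_mod_eq_one_of_conj hu hx1 hxu (by decide))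
      (not_two_pow_dvd_of_le (e := 3) (by omega) (by decide)) (not_two_pow_dvd_of_le (e := 2) (by omega) (by decide)) hA N
  · obtain ⟨u, a, x, hu, -, ha, -, -, -, hxa, hxx, -, hau, hxu⟩ := hdic
    obtain ⟨k, rfl⟩ : ∃ k, n = k + 2 := ⟨n - 2, by omega⟩
    exact hodgeConjectureFor_pow_of_shape_dic hdeg (by norm_num) (by norm_num) hu (by rw [ha, show k + 2 - 1 = k + 1 by omega])
      hau hxu hxa (by rw [hxx, Nat.add_sub_cancel]) hA N

/-- **The Hodge dichotomy for Galois CM fields of degree `2ⁿ·61`, `n ≥ 5`.** [cite: Pohlmann1968, Thm. 1]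
[cite: Shimura1998, §6.2 Thm. 3, §8.2 Prop. 26 and §32.10] [cite: Gordon1999HodgeAVSurvey, Thm. 6.4 and §9.3] -/
theorem hodge_dichotomy_sixtyone [IsGalois ℚ K] {n : ℕ} (hdeg : Module.finrank ℚ K = 2 ^ n * 61) (hn : 5 ≤ n) :
    (∀ (Φ : CMType K) (A : AbelianVariety ℂ) (ι : 𝓞 K →+* End A) (θ : K →+* Module.End ℂ (complexBetti A.X 1)),
        IsCMTypeRealisation Φ A ι θ → ∀ N : ℕ, HodgeConjectureFor (⨁ fun _ : Fin N => A).dim (⨁ fun _ : Fin N => A).X) ∨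
      ∃ (Φ : CMType K) (φ : K →+* ℂ) (X : AbelianVariety ℂ) (ι : 𝓞 K →+* End X)
        (ϑ : K →+* Module.End ℂ (complexBetti X.X 1)),
        IsPrimitive (ℂ ≃+* ℂ) Φ.1 φ ∧ ¬ IsNondegenerate Φ ∧ IsCMTypeRealisation Φ X ι ϑ ∧ X.IsSimple ∧
        X.dim = Module.finrank ℚ K / 2 ∧
        ∃ n p : ℕ, ∃ x : complexBetti (⨁ fun _ : Fin n => X).X (2 * p), IsRationalClass x ∧
          IsOfHodgeType (⨁ fun _ : Fin n => X).dim (⨁ fun _ : Fin n => X).X (2 * p) p p x ∧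
          x ∉ divisorClassesSpan (⨁ fun _ : Fin n => X).X (⨁ fun _ : Fin n => X).dim p := by
  by_cases hgood : ∀ (Ψ : CMType K) (φ : K →+* ℂ), IsPrimitive (ℂ ≃+* ℂ) Ψ.1 φ → IsNondegenerate Ψ
  · exact Or.inl fun Φ A ι θ hA N => hodgeConjectureFor_pow_of_forall_isNondegenerate_sixtyone hdeg hn hgood hA N
  · exact Or.inr (exists_simple_degenerate_of_not_forall_isNondegenerate hgood)

/-- **`Gal(K/ℚ) ≅ Q_{8k} × C₆₁` IS BAD** for every `k ≥ 1`. [cite: Shimura1998, §6.2 Thm. 3 and §8.2 Prop. 26]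
[cite: Gordon1999HodgeAVSurvey, Thm. 6.4 and §9.3] -/
theorem exists_simple_degenerate_of_mulEquiv_quaternion_prod_cyclic61 [IsGalois ℚ K] {k : ℕ} [NeZero k]
    (e : (K ≃ₐ[ℚ] K) ≃* QuaternionGroup (2 * k) × Multiplicative (ZMod 61)) :
    ∃ (Φ : CMType K) (φ₀ : K →+* ℂ) (A : AbelianVariety ℂ) (ι : 𝓞 K →+* End A)
      (θ : K →+* Module.End ℂ (complexBetti A.X 1)),
      IsPrimitive (ℂ ≃+* ℂ) Φ.1 φ₀ ∧ ¬ IsNondegenerate Φ ∧ IsCMTypeRealisation Φ A ι θ ∧ A.IsSimple ∧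
      A.dim = Module.finrank ℚ K / 2 ∧
      ∃ n p : ℕ, ∃ x : complexBetti (⨁ fun _ : Fin n => A).X (2 * p), IsRationalClass x ∧
        IsOfHodgeType (⨁ fun _ : Fin n => A).dim (⨁ fun _ : Fin n => A).X (2 * p) p p x ∧
        x ∉ divisorClassesSpan (⨁ fun _ : Fin n => A).X (⨁ fun _ : Fin n => A).dim p := by
  have hk : 0 < k := Nat.pos_of_ne_zero (NeZero.ne k)
  set A₀ : QuaternionGroup (2 * k) × Multiplicative (ZMod 61) := (a (k : ZMod (2 * (2 * k))), 1) with hA₀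
  set X₀ : QuaternionGroup (2 * k) × Multiplicative (ZMod 61) := (xa 0, 1) with hX₀
  set u₀ : QuaternionGroup (2 * k) × Multiplicative (ZMod 61) := (1, Multiplicative.ofAdd 1) with hu₀
  have hkval : ((k : ℕ) : ZMod (2 * (2 * k))).val = k := by
    rw [ZMod.val_natCast]
    exact Nat.mod_eq_of_lt (by omega)
  have hA₀ord : orderOf A₀ = 4 := by
    rw [hA₀, Prod.orderOf_mk, orderOf_one, Nat.lcm_one_right, orderOf_a, hkval,
      show 2 * (2 * k) = 4 * k by ring, Nat.gcd_mul_left_left, Nat.mul_div_cancel _ hk]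
  have hA₀sq : A₀ ^ 2 = (a (2 * k : ℕ), 1) := by
    rw [hA₀, pow_two, Prod.mk_mul_mk, a_mul_a, mul_one]
    congr 1
    congr 1
    push_cast
    ring
  have hX₀sq : X₀ * X₀ = A₀ ^ 2 := by
    rw [hA₀sq, hX₀, Prod.mk_mul_mk, xa_mul_xa, mul_one]
    congr 1
    congr 1
    push_cast
    ring
  have hXA₀ : X₀ * A₀ * X₀⁻¹ = A₀⁻¹ := by
    have hinv : A₀⁻¹ = (a (-(k : ZMod (2 * (2 * k)))), 1) := by
      rw [hA₀, Prod.inv_mk, inv_one]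
      congr 1
    rw [mul_inv_eq_iff_eq_mul, hinv, hX₀, hA₀, Prod.mk_mul_mk, Prod.mk_mul_mk, xa_mul_a, a_mul_xa, zero_add, zero_sub,
      neg_neg]
  have hcomm : ∀ y : QuaternionGroup (2 * k) × Multiplicative (ZMod 61), y * u₀ = u₀ * y := fun y => by
    rw [hu₀]
    ext
    · simp
    · change y.2 * Multiplicative.ofAdd 1 = Multiplicative.ofAdd 1 * y.2
      exact mul_comm _ _
  have hu₀ord : orderOf u₀ = 61 := by
    rw [hu₀, Prod.orderOf_mk, orderOf_one, Nat.lcm_one_left, orderOf_ofAdd_eq_addOrderOf, ZMod.addOrderOf_one]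
  have hc : e ((IsCMField.complexConj K).restrictScalars ℚ) = A₀ ^ 2 := by
    rw [hA₀sq]
    exact map_complexConj_eq_of_mulEquiv_quaternion_prod (by decide) e
  have hA : orderOf (e.symm A₀) = 4 := by rw [MulEquiv.orderOf_eq, hA₀ord]
  have hX : e.symm X₀ * e.symm X₀ = e.symm A₀ ^ 2 := by rw [← map_mul, hX₀sq, map_pow]
  have hXA : e.symm X₀ * e.symm A₀ * (e.symm X₀)⁻¹ = (e.symm A₀)⁻¹ := by
    rw [← map_mul, ← map_inv, ← map_mul, hXA₀, map_inv]
  have hc' : e.symm A₀ ^ 2 = (IsCMField.complexConj K).restrictScalars ℚ := by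
    rw [← map_pow, ← hc, MulEquiv.symm_apply_apply]
  have hu : orderOf (e.symm u₀) = 61 := by rw [MulEquiv.orderOf_eq, hu₀ord]
  have hAu : e.symm A₀ * e.symm u₀ = e.symm u₀ * e.symm A₀ := by rw [← map_mul, hcomm, map_mul]
  have hXu : e.symm X₀ * e.symm u₀ = e.symm u₀ * e.symm X₀ := by rw [← map_mul, hcomm, map_mul]
  haveI hnorm : (Subgroup.zpowers (e.symm u₀)).Normal := by
    refine ⟨fun n hn g => ?_⟩
    obtain ⟨j, rfl⟩ := Subgroup.mem_zpowers_iff.mp hn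
    have hcg : Commute (e.symm u₀) g := by
      have := hcomm (e g)
      apply_fun e.symm at this
      rw [map_mul, map_mul, MulEquiv.symm_apply_apply] at this
      exact this.symm
    rw [← (hcg.zpow_left j).eq, mul_inv_cancel_right]
    exact Subgroup.zpow_mem _ (Subgroup.mem_zpowers _) _
  exact exists_simple_degenerate_of_quaternionEight_cyclic61_subgroup hA hX hXA hc' hu hAu hXu hnorm

end Summit.HodgeConjecture.CorCM.GaloisModels

end
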